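import Mathlib

/-!
# Route NoetherLefschetzOneUp — `LevelZeroNets` (stmt-HodgeConjecture-11602), I:
# the algebraic core of the connected-fibres bridge

The support item `LevelZeroNets` of route `route-HodgeConjecture-NoetherLefschetzOneUp` is Arapura's
theorem (Pacific J. Math. 319 (2022), Cor. 1.5: the Hodge conjecture for a fourfold fibred over a
surface by surfaces of geometric genus zero) at the base `ℙ²_ℂ`, with the conclusion weakened to
"algebraic ⊔ vertical". The tree holds Cor. 1.5 as the named fact
`Literature.AlgebraicGeometry.HodgeTheory.Arapura2022_hodgeConjecture_pgZeroSurfaceFibration`, whose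
standing hypothesis "`f` has connected fibres" (ALL fibres) is NOT among the item's hypotheses: the
item only says that the fibres over the complex points off a proper Zariski-closed `T ⊆ ℙ²` are
smooth projective (geometrically irreducible) surfaces. The passage "general closed fibre connected
⇒ all fibres connected" is Zariski's connectedness theorem / Stein factorisation together with a
characteristic-zero argument; this file proves its commutative-algebra core, the sequel
(`NoetherLefschetzOneUpLevelZeroNetsStein`) the scheme-theoretic statement, and
`NoetherLefschetzOneUpLevelZeroNets` the item conditional on the named fact.

## Content

* `LevelZeroNetsStein.exists_mul_add_mul_derivative_eq_C` — for a monic irreducible `p` over an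
  integrally closed domain of characteristic zero, `u p + v p' = c` with `c ≠ 0` (Gauss's lemma,
  separability over the fraction field, clearing denominators).
* `LevelZeroNetsStein.surjective_algebraMap_of_subsingleton_maximal_over` — THE CORE: `A` an
  integrally closed domain of finite type over an algebraically closed field `k` of characteristic
  zero, `B ⊇ A` a domain integral over `A`; if above every maximal ideal of `A` off a proper closed
  subset there is at most one maximal ideal of `B`, then `B = A`. (In characteristic `p` this is
  false — purely inseparable covers — which is why separability enters.)

Standard commutative algebra (e.g. the argument behind "a finite morphism of degree `d` onto a
normal variety in characteristic `0` has `d` points in its general fibre"); no single source.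
-/

-- `Summit.HodgeConjecture.HodgeConjecture.Theorems` is the mandated namespace (single-problem
-- summit: Problem = Summit), which `linter.dupNamespace` flags; restated here so stand-alone
-- elaboration is warning-free.
set_option linter.dupNamespace false

noncomputable section

namespace Summit.HodgeConjecture.HodgeConjecture.Theorems

namespace LevelZeroNetsStein

open Polynomial

/-- **Separability modulo a general maximal ideal.** For a monic polynomial `p` over an
integrally closed domain `A` of characteristic zero which is irreducible over `A`, there are
`c ≠ 0` in `A` and `u v ∈ A[X]` with `u * p + v * p' = C c`: `p` is irreducible over the fraction
field `K` (Gauss), hence separable there (characteristic zero), and one clears denominators in a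
Bézout relation `u' p + v' p' = 1` over `K`. -/
theorem exists_mul_add_mul_derivative_eq_C {A : Type*} [CommRing A] [IsDomain A]
    [IsIntegrallyClosed A] [CharZero A] {p : A[X]} (hp : p.Monic) (hirr : Irreducible p) :
    ∃ c : A, c ≠ 0 ∧ ∃ u v : A[X], u * p + v * derivative p = C c := by
  classical
  let K := FractionRing A
  haveI : CharZero K := charZero_of_injective_algebraMap (IsFractionRing.injective A K)
  have hsep : (p.map (algebraMap A K)).Separable :=
    ((hp.irreducible_iff_irreducible_map_fraction_map).mp hirr).separable
  obtain ⟨u', v', h⟩ := hsep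
  obtain ⟨cu, hcu, hu⟩ := IsLocalization.integerNormalization_spec (nonZeroDivisors A) u'
  obtain ⟨cv, hcv, hv⟩ := IsLocalization.integerNormalization_spec (nonZeroDivisors A) v'
  refine ⟨cu * cv, mul_ne_zero (nonZeroDivisors.ne_zero hcu) (nonZeroDivisors.ne_zero hcv),
    C cv * IsLocalization.integerNormalization (nonZeroDivisors A) u',
    C cu * IsLocalization.integerNormalization (nonZeroDivisors A) v', ?_⟩
  apply Polynomial.map_injective (algebraMap A K) (IsFractionRing.injective A K)
  rw [Polynomial.derivative_map] at h
  simp only [Polynomial.map_add, Polynomial.map_mul, Polynomial.map_C, hu, hv, map_mul]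
  rw [Algebra.smul_def, Algebra.smul_def, Polynomial.algebraMap_apply, Polynomial.algebraMap_apply]
  linear_combination (C (algebraMap A K cu) * C (algebraMap A K cv)) * h

/-- **The algebraic core.** Let `k` be an algebraically closed field of characteristic zero, `A` an
integrally closed domain of finite type over `k`, and `B ⊇ A` a domain, integral over `A`. If for
every maximal ideal `m` of `A` off a proper closed subset (`c₀ ∉ m`) there is at most one maximal
ideal of `B` above `m`, then `B = A`. Proof: for `b ∈ B` with minimal polynomial `p` over `A`
(monic, irreducible, coefficients in `A` as `A` is integrally closed) of degree `d ≥ 2`, choose a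
maximal `m` with `c₀ c ∉ m` (`c` from `exists_mul_add_mul_derivative_eq_C`; `A` is Jacobson); then
`p mod m ∈ k[X]` is separable of degree `d`, so has two distinct roots `α ≠ β` in `k = A/m`; the
kernels of `A[b] ≅ A[X]/(p) → k`, `b ↦ α, β` are distinct maximal ideals above `m`, and they lift
to distinct maximal ideals of `B` above `m` (lying over) — a contradiction. Hence `d = 1`,
`b ∈ A`. -/
theorem surjective_algebraMap_of_subsingleton_maximal_over
    {k A B : Type*} [Field k] [IsAlgClosed k] [CharZero k]
    [CommRing A] [IsDomain A] [IsIntegrallyClosed A] [Algebra k A] [Algebra.FiniteType k A]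
    [CommRing B] [IsDomain B] [Algebra A B] [FaithfulSMul A B] [Algebra.IsIntegral A B]
    {c₀ : A} (hc₀ : c₀ ≠ 0)
    (H : ∀ m : Ideal A, m.IsMaximal → c₀ ∉ m → ∀ Q₁ Q₂ : Ideal B, Q₁.IsMaximal → Q₂.IsMaximal →
      Q₁.comap (algebraMap A B) = m → Q₂.comap (algebraMap A B) = m → Q₁ = Q₂) :
    Function.Surjective (algebraMap A B) := by
  classical
  intro b
  haveI : IsJacobsonRing A := isJacobsonRing_of_finiteType (A := k) (B := A)
  haveI : CharZero A := charZero_of_injective_algebraMap (algebraMap k A).injective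
  have hb : IsIntegral A b := Algebra.IsIntegral.isIntegral b
  set p := minpoly A b with hp_def
  have hpmonic : p.Monic := minpoly.monic hb
  have hpirr : Irreducible p := minpoly.irreducible hb
  -- it suffices to show `deg p ≤ 1`
  suffices hdeg : p.natDegree ≤ 1 by
    have h1 : p.natDegree = 1 := le_antisymm hdeg (minpoly.natDegree_pos hb)
    have h1' : p.degree = 1 := by
      rw [Polynomial.degree_eq_natDegree hpmonic.ne_zero, h1]; rfl
    obtain ⟨a, ha⟩ := minpoly.mem_range_of_degree_eq_one A b h1'
    exact ⟨a, ha⟩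
  by_contra hlt
  push Not at hlt
  -- separability witness and a good maximal ideal
  obtain ⟨c, hc, u, v, huv⟩ := exists_mul_add_mul_derivative_eq_C hpmonic hpirr
  obtain ⟨m, hm, hcm⟩ : ∃ m : Ideal A, m.IsMaximal ∧ c * c₀ ∉ m := by
    have hJ : (⊥ : Ideal A).jacobson = ⊥ :=
      IsJacobsonRing.out ‹_› (Ideal.IsPrime.isRadical inferInstance)
    have hnot : c * c₀ ∉ (⊥ : Ideal A).jacobson := by
      rw [hJ, Ideal.mem_bot]; exact mul_ne_zero hc hc₀
    rw [Ideal.jacobson, Ideal.mem_sInf] at hnot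
    push Not at hnot
    obtain ⟨m, ⟨-, hm⟩, hcm⟩ := hnot
    exact ⟨m, hm, hcm⟩
  have hc_m : c ∉ m := fun h => hcm (m.mul_mem_right _ h)
  have hc₀_m : c₀ ∉ m := fun h => hcm (m.mul_mem_left _ h)
  -- the residue field `A/m` is `k`
  letI : Field (A ⧸ m) := Ideal.Quotient.field m
  haveI : Module.Finite k (A ⧸ m) := finite_of_finite_type_of_isJacobsonRing k (A ⧸ m)
  haveI : Algebra.IsIntegral k (A ⧸ m) := Algebra.IsIntegral.of_finite k _
  have hbij : Function.Bijective (algebraMap k (A ⧸ m)) :=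
    IsAlgClosed.algebraMap_bijective_of_isIntegral
  let e : k ≃+* (A ⧸ m) := RingEquiv.ofBijective _ hbij
  let φ : A →+* k := e.symm.toRingHom.comp (Ideal.Quotient.mk m)
  have hφsurj : Function.Surjective φ :=
    e.symm.surjective.comp Ideal.Quotient.mk_surjective
  have hφker : ∀ a, φ a = 0 ↔ a ∈ m := by
    intro a
    simp only [φ, RingHom.coe_comp, RingEquiv.toRingHom_eq_coe, RingHom.coe_coe,
      Function.comp_apply, map_eq_zero_iff _ e.symm.injective, Ideal.Quotient.eq_zero_iff_mem]
  -- `q = p mod m` is monic, separable, of degree `deg p ≥ 2`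
  set q : k[X] := p.map φ with hq_def
  have hqmonic : q.Monic := hpmonic.map φ
  have hqdeg : q.natDegree = p.natDegree := hpmonic.natDegree_map φ
  have hφc : φ c ≠ 0 := fun h => hc_m ((hφker c).mp h)
  have hqsep : q.Separable := by
    have h1 := congrArg (Polynomial.map φ) huv
    simp only [Polynomial.map_add, Polynomial.map_mul, Polynomial.map_C] at h1
    rw [← Polynomial.derivative_map, show p.map φ = q from rfl] at h1
    refine ⟨C (φ c)⁻¹ * u.map φ, C (φ c)⁻¹ * v.map φ, ?_⟩
    calc C (φ c)⁻¹ * u.map φ * q + C (φ c)⁻¹ * v.map φ * derivative q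
        = C (φ c)⁻¹ * (u.map φ * q + v.map φ * derivative q) := by ring
      _ = C (φ c)⁻¹ * C (φ c) := by rw [h1]
      _ = 1 := by rw [← C_mul, inv_mul_cancel₀ hφc, C_1]
  -- two distinct roots `α ≠ β` of `q` in `k`
  have hq0 : q ≠ 0 := hqmonic.ne_zero
  have hcard : q.roots.card = q.natDegree :=
    ((IsAlgClosed.splits q).natDegree_eq_card_roots).symm
  have hnodup : q.roots.Nodup := nodup_roots hqsep
  obtain ⟨α, β, hα, hβ, hαβ⟩ : ∃ α β, α ∈ q.roots ∧ β ∈ q.roots ∧ α ≠ β := by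
    have hs : q.roots.toFinset.card = q.roots.card := Multiset.toFinset_card_of_nodup hnodup
    have h2 : 1 < q.roots.toFinset.card := by rw [hs, hcard, hqdeg]; exact hlt
    obtain ⟨α, β, hα, hβ, hne⟩ := Finset.one_lt_card_iff.mp h2
    exact ⟨α, β, Multiset.mem_toFinset.mp hα, Multiset.mem_toFinset.mp hβ, hne⟩
  have hαroot : q.eval α = 0 := (mem_roots hq0).mp hα
  have hβroot : q.eval β = 0 := (mem_roots hq0).mp hβ
  -- each root gives a maximal ideal of `B` above `m` containing `b - a`, `φ a = root`
  have key : ∀ γ : k, q.eval γ = 0 → ∀ a : A, φ a = γ →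
      ∃ N : Ideal B, N.IsMaximal ∧ N.comap (algebraMap A B) = m ∧ b - algebraMap A B a ∈ N := by
    intro γ hγ a ha
    letI : Algebra A k := φ.toAlgebra
    have hev : p.eval₂ (algebraMap A k) γ = 0 := by
      rw [← Polynomial.eval_map]; exact hγ
    let ψ₀ : AdjoinRoot p →ₐ[A] k := AdjoinRoot.liftAlgHom p (Algebra.ofId A k) γ hev
    let e' := minpoly.equivAdjoin hb
    let ψ : ↥(Algebra.adjoin A {b}) →ₐ[A] k := ψ₀.comp e'.symm.toAlgHom
    have hψsurj : Function.Surjective ψ := fun y => by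
      obtain ⟨a', rfl⟩ := hφsurj y
      exact ⟨algebraMap A _ a', ψ.commutes a'⟩
    let M : Ideal ↥(Algebra.adjoin A {b}) := RingHom.ker ψ.toRingHom
    haveI hM : M.IsMaximal := RingHom.ker_isMaximal_of_surjective ψ.toRingHom hψsurj
    haveI : Algebra.IsIntegral ↥(Algebra.adjoin A {b}) B := Algebra.IsIntegral.tower_top A
    obtain ⟨N, hN, hNM⟩ := Ideal.exists_ideal_over_maximal_of_isIntegral (S := B) M (by
      intro x hx
      rw [RingHom.mem_ker] at hx
      have : x = 0 := Subtype.ext hx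
      rw [this]; exact M.zero_mem)
    have hbmem : b ∈ Algebra.adjoin A {b} := Algebra.self_mem_adjoin_singleton A b
    have he'root : e' (AdjoinRoot.root p) = ⟨b, hbmem⟩ := by
      simp only [e', minpoly.coe_equivAdjoin, AdjoinRoot.Minpoly.coe_toAdjoin]
      exact AdjoinRoot.liftAlgHom_root _ _ _ _
    have hsymm : e'.symm ⟨b, hbmem⟩ = AdjoinRoot.root p := e'.symm_apply_eq.mpr he'root.symm
    have hψb : ψ ⟨b, hbmem⟩ = γ := by
      change ψ₀ (e'.symm.toAlgHom ⟨b, hbmem⟩) = γ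
      rw [AlgEquiv.coe_toAlgHom, hsymm]
      exact AdjoinRoot.liftAlgHom_root _ _ _ _
    refine ⟨N, hN, ?_, ?_⟩
    · rw [IsScalarTower.algebraMap_eq A ↥(Algebra.adjoin A {b}) B, ← Ideal.comap_comap, hNM]
      ext a'
      simp only [Ideal.mem_comap, M, RingHom.mem_ker, AlgHom.toRingHom_eq_coe, AlgHom.coe_toRingHom,
        AlgHom.commutes]
      exact hφker a'
    · have hmemM : (⟨b, hbmem⟩ - algebraMap A _ a : ↥(Algebra.adjoin A {b})) ∈ M := by
        rw [RingHom.mem_ker, map_sub]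
        simp only [AlgHom.toRingHom_eq_coe, AlgHom.coe_toRingHom, AlgHom.commutes, hψb]
        rw [RingHom.algebraMap_toAlgebra, ha, sub_self]
      have : (⟨b, hbmem⟩ - algebraMap A _ a : ↥(Algebra.adjoin A {b})) ∈
          N.comap (algebraMap _ B) := by
        rw [hNM]; exact hmemM
      rw [Ideal.mem_comap, map_sub] at this
      convert this using 2
      · rfl
      · exact (IsScalarTower.algebraMap_apply A ↥(Algebra.adjoin A {b}) B a)
  obtain ⟨aα, haα⟩ := hφsurj α
  obtain ⟨aβ, haβ⟩ := hφsurj β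
  obtain ⟨Nα, hNα, hNαm, hbα⟩ := key α hαroot aα haα
  obtain ⟨Nβ, hNβ, hNβm, hbβ⟩ := key β hβroot aβ haβ
  have hEq : Nα = Nβ := H m hm hc₀_m Nα Nβ hNα hNβ hNαm hNβm
  have hdiff : algebraMap A B (aα - aβ) ∈ Nα := by
    have h := Nα.sub_mem (hEq ▸ hbβ) hbα
    have e1 : b - algebraMap A B aβ - (b - algebraMap A B aα) = algebraMap A B (aα - aβ) := by
      rw [map_sub]; ring
    rwa [e1] at h
  have hm' : aα - aβ ∈ m := by rw [← hNαm]; exact Ideal.mem_comap.mpr hdiff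
  have h0 : φ (aα - aβ) = 0 := (hφker _).mpr hm'
  rw [map_sub, haα, haβ, sub_eq_zero] at h0
  exact hαβ h0

end LevelZeroNetsStein

end Summit.HodgeConjecture.HodgeConjecture.Theorems

end
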